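import Mathlib.Analysis.Fourier.FiniteAbelian.PontryaginDuality
import Mathlib.Analysis.RCLike.Basic
import Mathlib.LinearAlgebra.Matrix.PosDef
import Mathlib.Algebra.Order.Star.Real
import Mathlib.Algebra.Polynomial.AlgebraMap
import HarnessLib

/-!
# Translation-invariant matrices on a finite abelian group: symbol, eigen-relation, kernel bound

Plane-wave calculus for real matrices `A : Matrix G G ℝ` indexed by a finite abelian group `G` that
are invariant under simultaneous translation of both indices (`A (x+g) (y+g) = A x y`, i.e.
convolution operators `A x y = a(y − x)`).  With the additive characters `ψ : AddChar G ℂ`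
(Mathlib's Pontryagin duality for finite abelian groups: `card (AddChar G ℂ) = card G`,
`Σ_ψ ψ(a) = |G|·[a = 0]`):

* `IsTranslationInvariant` is preserved by `1, +, −, •, Σ, *, ^` and real polynomials (`aeval`);
  the diagonal is constant (`diag_eq`) and `tr A = |G|·A 0 0` (`trace_eq`);
* the **symbol** `symbol A ψ := Σ_y A 0 y · ψ y` is additive, multiplicative on translation-invariant
  matrices (`symbol_mul` — the convolution theorem), hence `symbol (p(A)) ψ = p(symbol A ψ)`
  (`symbol_aeval`); every character is an eigenvector: `A ψ = symbol A ψ · ψ` (`mulVec_addChar`);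
* **Fourier inversion at the origin**: `Σ_ψ symbol A ψ = |G| · A 0 0` (`sum_symbol`);
* for SYMMETRIC translation-invariant `A` the symbol is real (`conj_symbol`), nonnegative when `A`
  is positive semidefinite (`symbol_re_nonneg`) and monotone in the Loewner order (`symbol_re_mono`);
* for positive semidefinite `M`, `|M x y| ≤ (M x x + M y y)/2` (`abs_apply_le_of_posSemidef`), whence
  the **kernel bound** `|A x y| ≤ A 0 0 = |G|⁻¹ Σ_ψ Re(symbol A ψ)` for positive semidefinite
  translation-invariant `A` (`abs_apply_le_avg_symbol`).

This is the standard Fourier diagonalisation of circulant / convolution operators, e.g.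
[cite: BauerschmidtBrydgesSlade2019, §1.5.1 (lattice Green function in Fourier variables)]; all
statements are [folklore].  It is the bridge from the algebraic finite-range decomposition
(`Literature/Analysis/Matrix/FiniteRangeDecomposition.lean`) to pointwise kernel bounds.
-/

noncomputable section

open Finset Polynomial
open scoped ComplexConjugate

namespace Literature.Analysis.Fourier

variable {G : Type*} [AddCommGroup G]

/-! ## Translation invariance -/

/-- `A` is invariant under simultaneous translation of both indices (a convolution operator).
[folklore] -/
def IsTranslationInvariant (A : Matrix G G ℝ) : Prop := ∀ g x y : G, A (x + g) (y + g) = A x y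

namespace IsTranslationInvariant

variable {A B : Matrix G G ℝ}

/-- `A x y = A 0 (y − x)`. [folklore] -/
theorem apply_eq (hA : IsTranslationInvariant A) (x y : G) : A x y = A 0 (y - x) := by
  have h := hA (-x) x y
  rw [add_neg_cancel, ← sub_eq_add_neg] at h
  exact h.symm

/-- The diagonal is constant. [folklore] -/
theorem diag_eq (hA : IsTranslationInvariant A) (x : G) : A x x = A 0 0 := by
  rw [hA.apply_eq x x, sub_self]

/-- `A 0 (−y) = A y 0`. [folklore] -/
theorem apply_zero_neg (hA : IsTranslationInvariant A) (y : G) : A 0 (-y) = A y 0 := by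
  rw [hA.apply_eq y 0, zero_sub]

/-- The identity is translation invariant. [folklore] -/
theorem one [DecidableEq G] : IsTranslationInvariant (1 : Matrix G G ℝ) := by
  intro g x y
  simp [Matrix.one_apply, add_left_inj]

/-- Zero is translation invariant. [folklore] -/
theorem zero : IsTranslationInvariant (0 : Matrix G G ℝ) := fun _ _ _ => rfl

/-- Sums. [folklore] -/
theorem add (hA : IsTranslationInvariant A) (hB : IsTranslationInvariant B) :
    IsTranslationInvariant (A + B) := fun g x y => by simp [hA g x y, hB g x y]

/-- Differences. [folklore] -/
theorem sub (hA : IsTranslationInvariant A) (hB : IsTranslationInvariant B) :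
    IsTranslationInvariant (A - B) := fun g x y => by simp [hA g x y, hB g x y]

/-- Scalar multiples. [folklore] -/
theorem smul (hA : IsTranslationInvariant A) (c : ℝ) : IsTranslationInvariant (c • A) :=
  fun g x y => by simp [hA g x y]

/-- Finite sums. [folklore] -/
theorem sum {ι : Type*} (s : Finset ι) {F : ι → Matrix G G ℝ}
    (h : ∀ k ∈ s, IsTranslationInvariant (F k)) : IsTranslationInvariant (∑ k ∈ s, F k) := by
  intro g x y
  rw [Matrix.sum_apply, Matrix.sum_apply]
  exact Finset.sum_congr rfl fun k hk => h k hk g x y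

/-- Products (convolution of convolutions). [folklore] -/
theorem mul [Fintype G] (hA : IsTranslationInvariant A) (hB : IsTranslationInvariant B) :
    IsTranslationInvariant (A * B) := by
  intro g x y
  simp only [Matrix.mul_apply]
  rw [← Equiv.sum_comp (Equiv.addRight g)]
  refine Fintype.sum_congr _ _ fun z => ?_
  simp [hA g x z, hB g z y]

/-- Powers. [folklore] -/
theorem pow [Fintype G] [DecidableEq G] (hA : IsTranslationInvariant A) (k : ℕ) :
    IsTranslationInvariant (A ^ k) := by
  induction k with
  | zero => rw [pow_zero]; exact one
  | succ k ih => rw [pow_succ]; exact ih.mul hA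

/-- Real polynomials. [folklore] -/
theorem aeval [Fintype G] [DecidableEq G] (hA : IsTranslationInvariant A) (p : ℝ[X]) :
    IsTranslationInvariant (Polynomial.aeval A p) := by
  rw [Polynomial.aeval_eq_sum_range]
  exact sum _ fun k _ => (hA.pow k).smul _

/-- `tr A = |G| · A 0 0`. [folklore] -/
theorem trace_eq [Fintype G] (hA : IsTranslationInvariant A) :
    A.trace = Fintype.card G * A 0 0 := by
  unfold Matrix.trace
  simp only [Matrix.diag_apply, hA.diag_eq]
  rw [Finset.sum_const, Finset.card_univ, nsmul_eq_mul]

end IsTranslationInvariant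

/-! ## The symbol -/

variable [Fintype G]

/-- **The symbol** (Fourier transform of the convolution kernel) `σ_A(ψ) := Σ_y A 0 y · ψ(y)`.
[folklore] -/
def symbol (A : Matrix G G ℝ) (ψ : AddChar G ℂ) : ℂ := ∑ y, (A 0 y : ℂ) * ψ y

variable {A B : Matrix G G ℝ} (ψ : AddChar G ℂ)

/-- `σ_1 = 1`. [folklore] -/
theorem symbol_one [DecidableEq G] : symbol (1 : Matrix G G ℝ) ψ = 1 := by
  unfold symbol
  rw [Finset.sum_eq_single (0 : G)]
  · simp
  · intro y _ hy; simp [Ne.symm hy]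
  · intro h; exact absurd (Finset.mem_univ _) h

/-- `σ_0 = 0`. [folklore] -/
theorem symbol_zero : symbol (0 : Matrix G G ℝ) ψ = 0 := by simp [symbol]

/-- Additivity. [folklore] -/
theorem symbol_add (A B : Matrix G G ℝ) : symbol (A + B) ψ = symbol A ψ + symbol B ψ := by
  simp [symbol, add_mul, Finset.sum_add_distrib]

/-- Differences. [folklore] -/
theorem symbol_sub (A B : Matrix G G ℝ) : symbol (A - B) ψ = symbol A ψ - symbol B ψ := by
  simp [symbol, sub_mul, Finset.sum_sub_distrib]

/-- Homogeneity. [folklore] -/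
theorem symbol_smul (c : ℝ) (A : Matrix G G ℝ) : symbol (c • A) ψ = c * symbol A ψ := by
  simp [symbol, Finset.mul_sum, mul_assoc]

/-- Finite sums. [folklore] -/
theorem symbol_sum {ι : Type*} (s : Finset ι) (F : ι → Matrix G G ℝ) :
    symbol (∑ k ∈ s, F k) ψ = ∑ k ∈ s, symbol (F k) ψ := by
  unfold symbol
  simp only [Matrix.sum_apply, Complex.ofReal_sum, Finset.sum_mul]
  rw [Finset.sum_comm]

/-- **The convolution theorem**: `σ_{AB} = σ_A · σ_B` (only `B` need be translation invariant).
[folklore] -/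
theorem symbol_mul (A : Matrix G G ℝ) (hB : IsTranslationInvariant B) :
    symbol (A * B) ψ = symbol A ψ * symbol B ψ := by
  unfold symbol
  simp only [Matrix.mul_apply, Complex.ofReal_sum, Complex.ofReal_mul, Finset.sum_mul]
  rw [Finset.sum_comm]
  refine Finset.sum_congr rfl fun y _ => ?_
  simp only [Finset.mul_sum]
  -- `Σ_z B y z ψ z = ψ y Σ_w B 0 w ψ w`, substituting `z = w + y`
  symm
  refine Fintype.sum_equiv (Equiv.addRight y) _ _ fun w => ?_
  simp only [Equiv.coe_addRight]
  rw [hB.apply_eq y (w + y), add_sub_cancel_right, AddChar.map_add_eq_mul]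
  ring

/-- Powers. [folklore] -/
theorem symbol_pow [DecidableEq G] (hA : IsTranslationInvariant A) (k : ℕ) :
    symbol (A ^ k) ψ = symbol A ψ ^ k := by
  induction k with
  | zero => rw [pow_zero, pow_zero, symbol_one]
  | succ k ih => rw [pow_succ, symbol_mul ψ _ hA, ih, pow_succ]

/-- **Polynomials**: `σ_{p(A)} = p(σ_A)`. [folklore] -/
theorem symbol_aeval [DecidableEq G] (hA : IsTranslationInvariant A) (p : ℝ[X]) :
    symbol (Polynomial.aeval A p) ψ = Polynomial.aeval (symbol A ψ) p := by
  rw [Polynomial.aeval_eq_sum_range, Polynomial.aeval_eq_sum_range, symbol_sum]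
  refine Finset.sum_congr rfl fun k _ => ?_
  rw [symbol_smul, symbol_pow ψ hA, Complex.real_smul]

/-- **Characters are eigenvectors**: `(A ψ)(x) = σ_A(ψ) ψ(x)`. [folklore] -/
theorem mulVec_addChar (hA : IsTranslationInvariant A) (x : G) :
    (A.map ((↑) : ℝ → ℂ)).mulVec (ψ : G → ℂ) x = symbol A ψ * ψ x := by
  simp only [Matrix.mulVec, dotProduct, Matrix.map_apply, symbol, Finset.sum_mul]
  rw [← Equiv.sum_comp (Equiv.addRight x)]
  refine Finset.sum_congr rfl fun w _ => ?_
  simp only [Equiv.coe_addRight]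
  rw [hA.apply_eq x (w + x), add_sub_cancel_right, AddChar.map_add_eq_mul]
  ring

/-- **Fourier inversion at the origin**: `Σ_ψ σ_A(ψ) = |G| · A 0 0`. [folklore] -/
theorem sum_symbol [DecidableEq G] (A : Matrix G G ℝ) :
    ∑ ψ : AddChar G ℂ, symbol A ψ = Fintype.card G * (A 0 0 : ℂ) := by
  unfold symbol
  rw [Finset.sum_comm]
  simp_rw [← Finset.mul_sum, AddChar.sum_apply_eq_ite]
  rw [Finset.sum_eq_single (0 : G)]
  · simp [mul_comm]
  · intro y _ hy; simp [hy]
  · intro h; exact absurd (Finset.mem_univ _) h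

/-- Real form of Fourier inversion at the origin: `A 0 0 = |G|⁻¹ Σ_ψ Re σ_A(ψ)`. [folklore] -/
theorem apply_zero_zero_eq_avg_symbol [DecidableEq G] (A : Matrix G G ℝ) :
    A 0 0 = (Fintype.card G : ℝ)⁻¹ * ∑ ψ : AddChar G ℂ, (symbol A ψ).re := by
  have h := congrArg Complex.re (sum_symbol A)
  rw [Complex.re_sum] at h
  rw [h]
  simp only [Complex.mul_re, Complex.natCast_re, Complex.ofReal_re, Complex.natCast_im,
    Complex.ofReal_im, mul_zero, sub_zero]
  have hc : (Fintype.card G : ℝ) ≠ 0 := Nat.cast_ne_zero.mpr Fintype.card_ne_zero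
  field_simp

/-- **Reality**: for a SYMMETRIC translation-invariant `A` the symbol is real. [folklore] -/
theorem conj_symbol (hA : IsTranslationInvariant A) (hs : A.IsHermitian) :
    conj (symbol A ψ) = symbol A ψ := by
  unfold symbol
  rw [map_sum]
  rw [← Equiv.sum_comp (Equiv.neg G)]
  refine Finset.sum_congr rfl fun y _ => ?_
  simp only [Equiv.neg_apply, map_mul, Complex.conj_ofReal]
  rw [AddChar.map_neg_eq_conj, hA.apply_zero_neg, Complex.conj_conj]
  have := congrFun (congrFun hs 0) y
  simp only [Matrix.conjTranspose_apply, star_trivial] at this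
  rw [this]

/-- The imaginary part of the symbol of a symmetric translation-invariant matrix vanishes. [folklore] -/
theorem symbol_im (hA : IsTranslationInvariant A) (hs : A.IsHermitian) : (symbol A ψ).im = 0 := by
  have h := congrArg Complex.im (conj_symbol ψ hA hs)
  rw [Complex.conj_im] at h
  linarith

omit [AddCommGroup G] in
/-- The real part of the Hermitian form of a REAL matrix on a complex vector is the sum of the real
quadratic forms of its real and imaginary parts. [folklore] -/
theorem re_star_dotProduct_map_mulVec (A : Matrix G G ℝ) (f : G → ℂ) :
    (star f ⬝ᵥ (A.map ((↑) : ℝ → ℂ)).mulVec f).re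
      = (fun x => (f x).re) ⬝ᵥ A.mulVec (fun x => (f x).re)
        + (fun x => (f x).im) ⬝ᵥ A.mulVec (fun x => (f x).im) := by
  simp only [dotProduct, Matrix.mulVec, Matrix.map_apply, Complex.re_sum, Finset.mul_sum,
    ← Finset.sum_add_distrib]
  refine Finset.sum_congr rfl fun x _ => Finset.sum_congr rfl fun y _ => ?_
  simp only [Pi.star_apply, Complex.star_def, Complex.mul_re, Complex.conj_re, Complex.conj_im,
    Complex.ofReal_re, Complex.ofReal_im, zero_mul, sub_zero, Complex.mul_im, add_zero]
  ring

/-- Characters never vanish. [folklore] -/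
theorem addChar_apply_ne_zero (x : G) : (ψ : G → ℂ) x ≠ 0 := by
  intro h0
  have h := AddChar.norm_apply ψ x
  rw [h0, norm_zero] at h
  exact zero_ne_one h

/-- `ψ† A ψ = |G| · σ_A(ψ)`. [folklore] -/
theorem star_dotProduct_mulVec_addChar (hA : IsTranslationInvariant A) :
    star (ψ : G → ℂ) ⬝ᵥ (A.map ((↑) : ℝ → ℂ)).mulVec (ψ : G → ℂ)
      = Fintype.card G * symbol A ψ := by
  simp only [dotProduct, Pi.star_apply]
  have key : ∀ x : G, star ((ψ : G → ℂ) x) * (A.map ((↑) : ℝ → ℂ)).mulVec (ψ : G → ℂ) x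
      = symbol A ψ := by
    intro x
    rw [mulVec_addChar ψ hA x, Complex.star_def, ← AddChar.inv_apply_eq_conj]
    field_simp [addChar_apply_ne_zero ψ x]
  simp_rw [key]
  rw [Finset.sum_const, Finset.card_univ, nsmul_eq_mul]

/-- **Positivity**: the symbol of a positive semidefinite translation-invariant matrix has
nonnegative real part (and is real, `symbol_im`). [folklore] -/
theorem symbol_re_nonneg (hA : IsTranslationInvariant A) (hP : A.PosSemidef) :
    0 ≤ (symbol A ψ).re := by
  have h1 := star_dotProduct_mulVec_addChar ψ hA
  have hnn : 0 ≤ (star (ψ : G → ℂ) ⬝ᵥ (A.map ((↑) : ℝ → ℂ)).mulVec (ψ : G → ℂ)).re := by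
    rw [re_star_dotProduct_map_mulVec A]
    have ha := hP.dotProduct_mulVec_nonneg (fun x => ((ψ : G → ℂ) x).re)
    have hb := hP.dotProduct_mulVec_nonneg (fun x => ((ψ : G → ℂ) x).im)
    simp only [star_trivial] at ha hb
    exact add_nonneg ha hb
  rw [h1] at hnn
  simp only [Complex.mul_re, Complex.natCast_re, Complex.natCast_im, zero_mul, sub_zero] at hnn
  have hc : (0 : ℝ) < Fintype.card G := Nat.cast_pos.mpr Fintype.card_pos
  exact (mul_nonneg_iff_of_pos_left hc).mp hnn

/-- **Loewner monotonicity of the symbol**: `A ≤ B ⇒ Re σ_A ≤ Re σ_B`. [folklore] -/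
theorem symbol_re_mono (hA : IsTranslationInvariant A) (hB : IsTranslationInvariant B)
    (h : (B - A).PosSemidef) : (symbol A ψ).re ≤ (symbol B ψ).re := by
  have := symbol_re_nonneg ψ (hB.sub hA) h
  rw [symbol_sub, Complex.sub_re] at this
  linarith

/-! ## Kernel bounds -/

omit [Fintype G] in
/-- For a positive semidefinite real matrix, `|M x y| ≤ (M x x + M y y)/2` (the `2 × 2` principal
minors). [folklore] -/
theorem abs_apply_le_of_posSemidef {V : Type*} [Fintype V] {M : Matrix V V ℝ}
    (hM : M.PosSemidef) (x y : V) : |M x y| ≤ (M x x + M y y) / 2 := by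
  have hN := hM.submatrix ![x, y]
  have hsymm : M y x = M x y := by
    have := congrFun (congrFun hM.1 x) y
    simpa [Matrix.conjTranspose_apply] using this
  have h1 := hN.dotProduct_mulVec_nonneg ![1, 1]
  have h2 := hN.dotProduct_mulVec_nonneg ![1, -1]
  simp [Matrix.mulVec, dotProduct, Fin.sum_univ_two, Matrix.submatrix_apply] at h1 h2
  rw [hsymm] at h1 h2
  rw [abs_le]
  constructor <;> linarith

/-- **Kernel bound for positive semidefinite convolution operators**:
`|A x y| ≤ A 0 0 = |G|⁻¹ Σ_ψ Re σ_A(ψ)`. [folklore] -/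
theorem abs_apply_le_avg_symbol [DecidableEq G] (hA : IsTranslationInvariant A) (hP : A.PosSemidef)
    (x y : G) : |A x y| ≤ (Fintype.card G : ℝ)⁻¹ * ∑ ψ : AddChar G ℂ, (symbol A ψ).re := by
  rw [← apply_zero_zero_eq_avg_symbol]
  calc |A x y| ≤ (A x x + A y y) / 2 := abs_apply_le_of_posSemidef hP x y
    _ = A 0 0 := by rw [hA.diag_eq x, hA.diag_eq y]; ring

end Literature.Analysis.Fourier

end
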